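import Literature.Analysis.FluidPDE.Vorticity
import Literature.Analysis.FluidPDE.LerayHopf
import Literature.Analysis.FluidPDE.SuitableWeak
import HarnessLib

/-!
# Continuous alignment of the vorticity direction excludes Type I blow-up (Giga–Miura 2011)

Topic `Analysis/FluidPDE`. Source: Y. Giga, H. Miura, *On vorticity directions near
singularities for the Navier–Stokes flows with infinite energy*, Comm. Math. Phys. **303**
(2011) 289–300 [GigaMiura2011] (paywalled, acquisition request acq-01588, cite-only). The
statement below is transcribed from the two verbatim restatements we hold and have read:
Giga–Gu–Hsu, Nonlinear Anal. 189 (2019) 111579 [GigaGuHsu2019], p. 2, "Theorem 1.1 ([15])"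
(`[15]` = Giga–Miura 2011), and Giga–Hsu–Maekawa, Comm. PDE 39 (2014) [GigaHsuMaekawa2014],
arXiv:1310.6471 §1, Theorem 1.2 and the paragraph after it (the half-space version "extending the
geometric regularity criterion in [GiMi]"; condition (CA) there is the one below).

## The result, as printed (Giga–Gu–Hsu 2019, Theorem 1.1, quoting Giga–Miura 2011)

"Let `(u, p)` be a spatially bounded mild solution to the Navier–Stokes system
`∂ₜu − Δu + div(u ⊗ u) + ∇p = 0`, `div u = 0` in `ℝ³ × (−1, 0)`. Assume that the possible blow-up
of `u` at time `0` is type I, i.e. `sup_{−1<t<0} (−t)^{1/2} ‖u(t)‖_∞ < ∞`. Let `d` be a positive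
number and let `η` be a non-decreasing continuous function on `[0, ∞)` satisfying `η(0) = 0`.
Assume that `η` is a modulus of continuity in the `x` variables for the vorticity direction
`ξ = ω/|ω|`, in the sense that `|ξ(x,t) − ξ(y,t)| ≤ η(|x − y|)` for `(x,t), (y,t) ∈ Q_d`, where
`Q_d = {(x,t) ∈ ℝ³ × (−1,0) : |ω(x,t)| > d}` (1.3). Then `u` is bounded up to `t = 0`."

Condition (1.3) is the **continuous alignment** condition ((CA) in Giga–Hsu–Maekawa 2014).
Giga–Hsu–Maekawa 2014, §1: "In [CoFe] the modulus `η` is taken as `η(σ) = Aσ` … while the type I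
condition is not needed there. The condition in [CoFe] was relaxed in [BaBe], where `η` is
allowed to be `η(σ) = Aσ^{1/2}`" — i.e. WITHOUT the Type I hypothesis only the Lipschitz
(Constantin–Fefferman 1993, in tree `Literature.Analysis.FluidPDE.constantin_fefferman`) and the
`1/2`-Hölder (Beirão da Veiga–Berselli 2002) moduli are known to suffice; the rate-free
criterion without Type I is the crux
`Summit.NavierStokesRegularity.NavierStokesRegularity.Theses.ContinuousAlignment.ContinuousAlignmentCriterion`,
which this fact does NOT give (it grounds that crux as its nearest print ancestor: the crux is
this theorem with the Type I hypothesis removed and with `|ξ(x,t) − ξ(y,t)| ≤ η` weakened to the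
Constantin–Fefferman sine condition `√(1 − ⟪ξ(x,t), ξ(y,t)⟫²) ≤ ε` for `|x − y| < δ(ε)`).

## Transcription into the tree's vocabulary

Packaged exactly as the accepted Type I exclusion `Literature.Analysis.FluidPDE.knss_no_axisymmetric_typeI`
(`Axisymmetric.lean`): physical space `ℝ³ = EuclideanSpace ℝ (Fin 3)`, time first; the solution
is a classical unforced Navier–Stokes solution of viscosity `ν > 0` on `ℝ³ × [0, T)`
(`IsClassicalNSSolutionOn (Ico 0 T) ν 0 u p`) which is Leray–Hopf on `[0, T)`
(`IsLerayHopfOn T ν 0 (u 0) u`; finite energy excludes the parasitic solutions `u = b(t)`, so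
that the bounded classical solution is the mild solution of the printed class) and bounded on
`ℝ³ × [0, T']` for every `T' < T` ("spatially bounded" before the candidate blow-up time); the
Type I hypothesis at `T` is the accepted `IsTypeIBlowup u T` (`‖u(t,x)‖ ≤ C/√(T − t)` for all `x`
and all `t < T` close to `T`; together with the boundedness on each `[0, T']` this is the printed
`sup_{0<t<T} (T − t)^{1/2} ‖u(t)‖_∞ < ∞`); the vorticity direction is
`vorticityDirection (curl (u t))` (`= ‖ω‖⁻¹ • ω`, the printed `ξ` wherever `|ω| > d > 0`); the
printed interval `(−1, 0)` with viscosity `1` becomes `(0, T)` with viscosity `ν` by translation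
and the Navier–Stokes scaling (both hypotheses are invariant, with new constants); and the printed
conclusion "`u` is bounded up to `t = T`" is recorded, for a Leray–Hopf classical solution, as
continuation past `T` (`HasSmoothExtensionPast ν 0 u T`: a classical finite-energy solution with
bounded velocity on `ℝ³ × [0, T)` continues as a classical solution past `T`, Leray 1934 / the
`L^∞` Prodi–Serrin criterion — the same recording step as in `knss_no_axisymmetric_typeI`).
-/

open Set Filter

namespace Literature.Analysis.FluidPDE

local notation "ℝ³" => EuclideanSpace ℝ (Fin 3)

/-- **Giga–Miura 2011 (continuous alignment excludes Type I blow-up; whole space).** Let `ν > 0`,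
`T > 0`, and let `(u, p)` be a classical unforced Navier–Stokes solution on `ℝ³ × [0, T)` which is
Leray–Hopf on `[0, T)` and bounded on `ℝ³ × [0, T']` for every `T' < T`. Assume the possible
blow-up at `T` is of Type I (`IsTypeIBlowup u T`), and assume **continuous alignment**: for some
`d > 0` and some modulus `η` (non-decreasing and continuous on `[0, ∞)`, `η 0 = 0`),
`‖ξ(x,t) − ξ(y,t)‖ ≤ η(‖x − y‖)` for all `t ∈ (0, T)` and all `x, y` with `|ω(x,t)| > d`,
`|ω(y,t)| > d`, where `ω = curl (u t)` and `ξ = vorticityDirection ω = ω/|ω|`. Then `T` is not a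
blow-up time: `u` is bounded up to `t = T`, hence continues as a classical solution past `T`.
Printed for spatially bounded mild solutions on `ℝ³ × (−1, 0)` with viscosity `1`
(Giga–Gu–Hsu 2019, Theorem 1.1, restating Giga–Miura 2011; Giga–Hsu–Maekawa 2014, Theorem 1.2 is
the half-space/no-slip analogue); see the module docstring for the transcription. Grounds (as
nearest print ancestor, NOT as a proof) the crux
`Summit.NavierStokesRegularity.NavierStokesRegularity.Theses.ContinuousAlignment.ContinuousAlignmentCriterion`,
which is this statement without the Type I hypothesis.
[cite: GigaMiura2011, main theorem (as restated verbatim in GigaGuHsu2019, Thm 1.1, p. 2)]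
[cite: GigaGuHsu2019, Thm 1.1 (p. 2)] [cite: GigaHsuMaekawa2014, Thm 1.2 and the remark following it (§1)] -/
def gigaMiura_continuousAlignment_typeI : Prop :=
  ∀ {ν T : ℝ} (_hν : 0 < ν) (_hT : 0 < T) {u : ℝ → ℝ³ → ℝ³} {p : ℝ → ℝ³ → ℝ}
    (_h : IsClassicalNSSolutionOn (Ico 0 T) ν 0 u p) (_hLH : IsLerayHopfOn T ν 0 (u 0) u)
    (_hbdd : ∀ T' < T, ∃ M : ℝ, ∀ t ∈ Icc 0 T', ∀ x, ‖u t x‖ ≤ M)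
    (_htypeI : IsTypeIBlowup u T)
    (_hCA : ∃ d : ℝ, 0 < d ∧ ∃ η : ℝ → ℝ, MonotoneOn η (Ici 0) ∧ ContinuousOn η (Ici 0) ∧ η 0 = 0 ∧
      ∀ t ∈ Ioo 0 T, ∀ x y : ℝ³, d < ‖curl (u t) x‖ → d < ‖curl (u t) y‖ →
        ‖vorticityDirection (curl (u t)) x - vorticityDirection (curl (u t)) y‖ ≤ η ‖x - y‖),
    HasSmoothExtensionPast ν 0 u T

end Literature.Analysis.FluidPDE
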